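import Literature.Analysis.DeBrangesSpaces.ReproducingKernel
import Mathlib.Analysis.SpecialFunctions.NonIntegrable
import Mathlib.MeasureTheory.Topology
import HarnessLib

/-!
# The reproducing identity of `𝓗(E)` for structure functions with real zeros

LABEL: RH-FREE (complex analysis of de Branges spaces over a GENERAL structure function; no
statement about `ζ` or RH; nothing here bears on the truth of RH). bears_on: B-C/B-P (COLUMN 6
DBR) only as infrastructure for `DeBranges1986Positivity*.lean`.

The tree's reproducing identity `deBrangesInner_deBrangesKernel` (`ReproducingKernel.lean`,
Conrey–Li 2000 (2.2)) assumes that the Hermite–Biehler function `E` has NO REAL ZEROS, because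
its proof applies Cauchy's theorem/formula along `ℝ` to the honest quotients `F/E`, `F♯/E`.
de Branges' theory (1968 book; 1986 Bull. AMS p. 3: "`K(w, z)` belongs to the space as a function
of `z` for every complex number `w` and `F(w) = (F(t), K(w, t))` for every element `F(z)` of the
space") has no such restriction: real zeros of `E` are allowed, and then every element of the
space vanishes there to at least the same order. This file removes the restriction:

* `exists_analyticAt_eventuallyEq_div`: if `E`, `F` are entire, `E ≢ 0` near the real point
  `x₀`, and `∫_ℝ ‖F/E‖² < ∞` (Lean's `a/0 = 0` at the zeros), then `F/E` agrees near `x₀`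
  (punctured) with a function analytic at `x₀` — the order of `F` at `x₀` is at least that of
  `E`, since otherwise `‖F/E‖² ≥ c/|x − x₀|` near `x₀`, which is not integrable
  (`not_intervalIntegrable_of_sub_inv_isBigO_punctured`);
* `exists_continuation_div`: hence `F/E` has a continuation `Q`, complex differentiable at every
  point of the closed upper half-plane, equal to `F/E` wherever `E ≠ 0`;
* `deBrangesInner_deBrangesKernel_of_isHermiteBiehler`: the reproducing identity
  `(F, K(w, ·))_{𝓗(E)} = F(w)` for EVERY Hermite–Biehler `E`, every entire `F` with
  `F/E ∈ L²(ℝ)` and the half-plane decay of Conrey–Li (2.2), and every non-real `w` — the tree's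
  proof run with the continuations, which agree with the quotients almost everywhere on `ℝ`
  (the real zero set of an entire `E ≢ 0` is countable).

Consumers: `DeBranges1986PositivityHolds.lean` (de Branges 1986 Thms 6–7 as printed, real zeros
included).

## References

* L. de Branges, Bull. AMS 15 (1986) 1–17, p. 3 (read) [deBranges1986]; *Hilbert spaces of
  entire functions* (1968), Thms 19–20.
* J. B. Conrey, X.-J. Li, IMRN 2000:18 = arXiv:math/9812166, §2 (2.2) [ConreyLi2000].
-/

noncomputable section

open scoped Real Topology ComplexConjugate
open _root_.Complex _root_.MeasureTheory _root_.Filter _root_.Set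

namespace Literature.Analysis.DeBrangesSpaces

variable {E : ℂ → ℂ}

/-- For entire `E`, `F`, the function `x ↦ F(x)/E(x)` is measurable on `ℝ` (no hypothesis on
the zeros of `E`). [folklore] -/
private theorem aestronglyMeasurable_div_of_differentiable' (hE : Differentiable ℂ E) {F : ℂ → ℂ}
    (hF : Differentiable ℂ F) : AEStronglyMeasurable (fun x : ℝ => F x / E x) volume :=
  ((hF.continuous.measurable.comp Complex.measurable_ofReal).div
    (hE.continuous.measurable.comp Complex.measurable_ofReal)).aestronglyMeasurable

/-! ### The real zero set of an entire function is null -/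

/-- For an entire function `E ≢ 0`, `E(x) ≠ 0` for almost every real `x` (the zero set is
discrete in `ℂ`, hence countable). [folklore] -/
private theorem ae_ne_zero_of_differentiable (hE : Differentiable ℂ E) {z₁ : ℂ} (h1 : E z₁ ≠ 0) :
    ∀ᵐ x : ℝ, E x ≠ 0 := by
  have hA : AnalyticOnNhd ℂ E univ := fun z _ => hE.analyticAt z
  rcases hA.eqOn_zero_or_eventually_ne_zero_of_preconnected isPreconnected_univ with h | h
  · exact absurd (h (mem_univ z₁)) h1
  · have hdisc : IsDiscrete ({z : ℂ | E z = 0} ∩ univ) :=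
      isDiscrete_of_codiscreteWithin (by rw [compl_setOf]; exact h)
    rw [inter_univ] at hdisc
    have hD : DiscreteTopology {z : ℂ | E z = 0} := isDiscrete_iff_discreteTopology.1 hdisc
    have hcount : ({z : ℂ | E z = 0}).Countable :=
      TopologicalSpace.separableSpace_iff_countable.1 inferInstance
    have hR : ({x : ℝ | E x = 0}).Countable := hcount.preimage Complex.ofReal_injective
    filter_upwards [hR.ae_notMem volume] with x hx
    exact hx

/-! ### Local structure of `F/E` at a real zero of `E` -/

/-- **Removable singularities from square integrability.** Let `E`, `F` be entire, `E ≢ 0`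
near the real point `x₀`, and `∫_ℝ |F/E|² < ∞` (with Lean's `a/0 = 0` at the zeros of `E`).
Then `F/E` agrees on a punctured neighbourhood of `x₀` with a function analytic at `x₀`: writing
`E = (z − x₀)ᵏ e₁`, `F = (z − x₀)ʲ f₁` with `e₁(x₀), f₁(x₀) ≠ 0`, the case `j < k` would give
`|F/E|² ≥ c/|x − x₀|` near `x₀`, which is not integrable. (The analytic input behind de Branges'
assertion that the elements of `𝓗(E)` are entire with `F(w) = (F(t), K(w, t))` also when `E` has
real zeros.) [cite: deBranges1986, p. 3] -/
theorem exists_analyticAt_eventuallyEq_div (hE : Differentiable ℂ E) {F : ℂ → ℂ}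
    (hF : Differentiable ℂ F) (hF2 : Integrable fun x : ℝ => ‖F x / E x‖ ^ 2) {x₀ : ℝ}
    (hE0 : analyticOrderAt E (x₀ : ℂ) ≠ ⊤) :
    ∃ q : ℂ → ℂ, AnalyticAt ℂ q x₀ ∧ ∀ᶠ u in 𝓝[≠] (x₀ : ℂ), F u / E u = q u := by
  obtain ⟨e₁, he₁, he₁0, hEeq⟩ := ((hE.analyticAt (x₀ : ℂ)).analyticOrderAt_ne_top).1 hE0
  set k : ℕ := analyticOrderNatAt E (x₀ : ℂ) with hk
  have he₁ne : ∀ᶠ u in 𝓝 (x₀ : ℂ), e₁ u ≠ 0 := he₁.continuousAt.eventually_ne he₁0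
  by_cases hFtop : analyticOrderAt F (x₀ : ℂ) = ⊤
  · refine ⟨fun _ => 0, analyticAt_const, ?_⟩
    have hF0 : ∀ᶠ u in 𝓝 (x₀ : ℂ), F u = 0 := analyticOrderAt_eq_top.1 hFtop
    filter_upwards [hF0.filter_mono nhdsWithin_le_nhds] with u hu
    simp [hu]
  obtain ⟨f₁, hf₁, hf₁0, hFeq⟩ := ((hF.analyticAt (x₀ : ℂ)).analyticOrderAt_ne_top).1 hFtop
  set j : ℕ := analyticOrderNatAt F (x₀ : ℂ) with hj
  by_cases hjk : k ≤ j
  · refine ⟨fun u => (u - x₀) ^ (j - k) * (f₁ u / e₁ u), ?_, ?_⟩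
    · exact ((analyticAt_id.sub analyticAt_const).pow _).mul (hf₁.div he₁ he₁0)
    · have hne : ∀ᶠ u in 𝓝[≠] (x₀ : ℂ), u ≠ (x₀ : ℂ) := self_mem_nhdsWithin
      filter_upwards [hne, (hEeq.and (hFeq.and he₁ne)).filter_mono nhdsWithin_le_nhds] with u hu h
      obtain ⟨hEu, hFu, he⟩ := h
      rw [hEu, hFu]
      simp only [smul_eq_mul]
      have hux : (u - x₀) ≠ 0 := sub_ne_zero.2 hu
      rw [← Nat.sub_add_cancel hjk, pow_add, Nat.add_sub_cancel]
      field_simp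
  · -- `j < k` contradicts the square integrability of `F/E`
    exfalso
    push Not at hjk
    set n : ℕ := k - j with hn
    have hn1 : 1 ≤ n := by omega
    have hkn : k = j + n := by omega
    -- the quotient on a punctured neighbourhood
    have hq : ∀ᶠ u in 𝓝 (x₀ : ℂ), u ≠ (x₀ : ℂ) →
        F u / E u = f₁ u / ((u - x₀) ^ n * e₁ u) ∧ e₁ u ≠ 0 := by
      filter_upwards [hEeq, hFeq, he₁ne] with u hEu hFu he hu
      refine ⟨?_, he⟩
      rw [hEu, hFu]
      simp only [smul_eq_mul]
      have hux : (u - x₀) ≠ 0 := sub_ne_zero.2 hu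
      rw [hkn, pow_add]
      field_simp
    -- bounds for `f₁`, `e₁` near `x₀`
    set A : ℝ := ‖f₁ x₀‖ / 2 with hA
    set B : ℝ := ‖e₁ x₀‖ + 1 with hB
    have hA0 : 0 < A := by
      have : 0 < ‖f₁ x₀‖ := norm_pos_iff.2 hf₁0
      rw [hA]; linarith
    have hB0 : 0 < B := by rw [hB]; positivity
    have hlow : ∀ᶠ u in 𝓝 (x₀ : ℂ), A ≤ ‖f₁ u‖ :=
      (continuous_norm.continuousAt.tendsto.comp hf₁.continuousAt).eventually_const_le
        (by rw [hA]; linarith [norm_pos_iff.2 hf₁0])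
    have hup : ∀ᶠ u in 𝓝 (x₀ : ℂ), ‖e₁ u‖ ≤ B :=
      (continuous_norm.continuousAt.tendsto.comp he₁.continuousAt).eventually_le_const
        (by rw [hB]; linarith)
    -- pull back to the real line
    have hreal : ∀ᶠ x : ℝ in 𝓝 x₀, ((x : ℂ) ≠ x₀ →
        F x / E x = f₁ x / (((x : ℂ) - x₀) ^ n * e₁ x) ∧ e₁ x ≠ 0) ∧ A ≤ ‖f₁ x‖ ∧ ‖e₁ x‖ ≤ B :=
      (Complex.continuous_ofReal.tendsto x₀).eventually (hq.and (hlow.and hup))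
    have hIcc : ∀ᶠ x : ℝ in 𝓝 x₀, |x - x₀| ≤ 1 := by
      have : Icc (x₀ - 1) (x₀ + 1) ∈ 𝓝 x₀ := Icc_mem_nhds (by linarith) (by linarith)
      filter_upwards [this] with x hx
      exact abs_le.2 ⟨by linarith [hx.1], by linarith [hx.2]⟩
    have hbig : ∀ᶠ x : ℝ in 𝓝[≠] x₀,
        ‖(x - x₀)⁻¹‖ ≤ B ^ 2 / A ^ 2 * ‖‖F x / E x‖ ^ 2‖ := by
      have hne : ∀ᶠ x : ℝ in 𝓝[≠] x₀, x ≠ x₀ := self_mem_nhdsWithin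
      filter_upwards [hne, (hreal.and hIcc).filter_mono nhdsWithin_le_nhds] with x hx h
      obtain ⟨⟨h1, hAx, hBx⟩, ht1⟩ := h
      have hx' : (x : ℂ) ≠ x₀ := fun h => hx (by exact_mod_cast h)
      obtain ⟨hqx, hex⟩ := h1 hx'
      set t : ℝ := |x - x₀| with ht
      have ht0 : 0 < t := abs_pos.2 (sub_ne_zero.2 hx)
      have htn : t ^ n ≤ t := by
        calc t ^ n ≤ t ^ 1 := pow_le_pow_of_le_one ht0.le ht1 hn1
          _ = t := pow_one t
      set N : ℝ := ‖F x / E x‖ with hN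
      have hN0 : 0 ≤ N := norm_nonneg _
      -- `A ≤ N * t ^ n * ‖e₁ x‖ ≤ N * t * B`
      have hnorm : ‖F x / E x‖ = ‖f₁ x‖ / (t ^ n * ‖e₁ x‖) := by
        rw [hqx, norm_div, norm_mul, norm_pow, ht]
        congr 2
        rw [← Complex.ofReal_sub, Complex.norm_real, Real.norm_eq_abs]
      have hden : 0 < t ^ n * ‖e₁ x‖ := mul_pos (pow_pos ht0 n) (norm_pos_iff.2 hex)
      have h2 : ‖f₁ x‖ = N * (t ^ n * ‖e₁ x‖) := by
        rw [hN, hnorm, div_mul_cancel₀ _ hden.ne']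
      have h3 : A ≤ N * (t * B) := by
        calc A ≤ ‖f₁ x‖ := hAx
          _ = N * (t ^ n * ‖e₁ x‖) := h2
          _ ≤ N * (t * B) := by
              refine mul_le_mul_of_nonneg_left ?_ hN0
              exact mul_le_mul htn hBx (norm_nonneg _) ht0.le
      have h4 : A ^ 2 ≤ N ^ 2 * t ^ 2 * B ^ 2 := by
        have := pow_le_pow_left₀ hA0.le h3 2
        nlinarith
      have h5 : A ^ 2 ≤ N ^ 2 * t * B ^ 2 := by
        have : t ^ 2 ≤ t := by nlinarith
        nlinarith [sq_nonneg N, sq_nonneg B]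
      rw [Real.norm_of_nonneg (sq_nonneg _), norm_inv, Real.norm_eq_abs, ← ht]
      rw [inv_le_iff_one_le_mul₀ ht0]
      have hA2 : 0 < A ^ 2 := pow_pos hA0 2
      calc (1 : ℝ) = A ^ 2 / A ^ 2 := (div_self hA2.ne').symm
        _ ≤ N ^ 2 * t * B ^ 2 / A ^ 2 := div_le_div_of_nonneg_right h5 hA2.le
        _ = B ^ 2 / A ^ 2 * N ^ 2 * t := by ring
    have hO : (fun x : ℝ => (x - x₀)⁻¹) =O[𝓝[≠] x₀] fun x : ℝ => ‖F x / E x‖ ^ 2 :=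
      Asymptotics.IsBigO.of_bound _ hbig
    have hint : IntervalIntegrable (fun x : ℝ => ‖F x / E x‖ ^ 2) volume (x₀ - 1) (x₀ + 1) :=
      hF2.intervalIntegrable
    exact not_intervalIntegrable_of_sub_inv_isBigO_punctured hO (by linarith)
      (Set.mem_uIcc.2 (Or.inl ⟨by linarith, by linarith⟩)) hint

/-! ### The continuation of `F/E` to the closed upper half-plane -/

/-- **The quotient `F/E` continued across the real zeros of `E`.** For a structure function `E`
and an entire `F` with `F/E` square integrable on `ℝ`, there is a function `Q`, complex
differentiable at every point of the closed upper half-plane, agreeing with `F/E` wherever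
`E ≠ 0` (in particular on the open upper half-plane and almost everywhere on `ℝ`).
[cite: deBranges1986, p. 3] -/
theorem exists_continuation_div (hE : IsHermiteBiehler E) {F : ℂ → ℂ} (hF : Differentiable ℂ F)
    (hF2 : Integrable fun x : ℝ => ‖F x / E x‖ ^ 2) :
    ∃ Q : ℂ → ℂ, (∀ z : ℂ, 0 ≤ z.im → DifferentiableAt ℂ Q z) ∧
      (∀ z : ℂ, E z ≠ 0 → Q z = F z / E z) := by
  classical
  have hd := hE.differentiable
  refine ⟨fun z => if E z = 0 then limUnder (𝓝[≠] z) (fun u => F u / E u) else F z / E z,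
    fun z hz => ?_, fun z hEz => by simp only [hEz, if_false]⟩
  by_cases hEz : E z = 0
  · -- a real zero of `E`
    have hzreal : z.im = 0 := by
      rcases hz.lt_or_eq with h | h
      · exact absurd hEz (hE.ne_zero_of_im_pos h)
      · exact h.symm
    have hE0 : analyticOrderAt E z ≠ ⊤ := by
      intro htop
      have hev := analyticOrderAt_eq_top.1 htop
      have hA : AnalyticOnNhd ℂ E univ := fun u _ => hd.analyticAt u
      have := hA.eqOn_zero_of_preconnected_of_eventuallyEq_zero isPreconnected_univ
        (mem_univ z) hev
      exact hE.ne_zero_of_im_pos (z := I) (by simp) (this (mem_univ I))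
    have hzeq : ((z.re : ℝ) : ℂ) = z := Complex.ext (by simp) (by simp [hzreal])
    have hE0' : analyticOrderAt E ((z.re : ℝ) : ℂ) ≠ ⊤ := by rwa [hzeq]
    obtain ⟨q, hq, hqe⟩ := exists_analyticAt_eventuallyEq_div hd hF hF2 hE0'
    rw [hzeq] at hq hqe
    have hEne : ∀ᶠ u in 𝓝[≠] z, E u ≠ 0 :=
      ((hd.analyticAt z).eventually_eq_zero_or_eventually_ne_zero).resolve_left
        fun h => hE0 (analyticOrderAt_eq_top.2 h)
    have hlim : Tendsto (fun u => F u / E u) (𝓝[≠] z) (𝓝 (q z)) :=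
      (hq.continuousAt.tendsto.mono_left nhdsWithin_le_nhds).congr'
        (hqe.mono fun u hu => hu.symm)
    have hval : limUnder (𝓝[≠] z) (fun u => F u / E u) = q z := hlim.limUnder_eq
    have hQ : (fun z => if E z = 0 then limUnder (𝓝[≠] z) (fun u => F u / E u) else F z / E z)
        =ᶠ[𝓝 z] q := by
      have h1 : ∀ᶠ u in 𝓝 z, u ≠ z → (E u ≠ 0 ∧ F u / E u = q u) :=
        eventually_nhdsWithin_iff.1 (hEne.and hqe)
      filter_upwards [h1] with u hu
      by_cases huz : u = z
      · subst huz
        simp only [hEz]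
        exact hval
      · obtain ⟨hEu, hqu⟩ := hu huz
        simp only [hEu, if_false]
        exact hqu
    exact hq.differentiableAt.congr_of_eventuallyEq hQ
  · -- `E z ≠ 0`: locally the honest quotient
    have hne : ∀ᶠ u in 𝓝 z, E u ≠ 0 := hd.continuous.continuousAt.eventually_ne hEz
    have hQ : (fun z => if E z = 0 then limUnder (𝓝[≠] z) (fun u => F u / E u) else F z / E z)
        =ᶠ[𝓝 z] fun u => F u / E u := by
      filter_upwards [hne] with u hu
      simp only [hu, if_false]
    exact ((hF z).div (hd z) hEz).congr_of_eventuallyEq hQ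

/-! ### The reproducing identity -/

/-- The integrand of `(F, K(w, ·))_{𝓗(E)}` on the real axis, split along `F/E` and `F♯/E`,
pointwise INCLUDING the real zeros of `E` (both sides vanish there). [cite: ConreyLi2000,
§2 (2.2)] -/
theorem inner_kernel_integrand' (F : ℂ → ℂ) {w : ℂ} (hw : w.im ≠ 0) (x : ℝ) :
    F x * conj (deBrangesKernel E w x) / ((‖E x‖ : ℂ) ^ 2) =
      (2 * π * I)⁻¹ * (E w * (F x / E x / (x - w)) -
        sharp E w * conj (sharp F x / E x / (x - conj w))) := by
  by_cases hEx : E x = 0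
  · simp [hEx]
  have hEx' : conj (E x) ≠ 0 := (map_ne_zero _).2 hEx
  have hxw : (x : ℂ) - w ≠ 0 := by
    intro h
    have := congrArg Complex.im h
    simp only [sub_im, ofReal_im, zero_sub, zero_im, neg_eq_zero] at this
    exact hw this
  have hπ : (2 * π * I : ℂ) ≠ 0 := by simp [Real.pi_ne_zero]
  rw [conj_deBrangesKernel, ← Complex.mul_conj' (E x)]
  simp only [deBrangesKernel, sharp_apply, Complex.conj_ofReal, Complex.conj_conj, map_div₀,
    map_sub]
  field_simp

/-- **The reproducing identity of `𝓗(E)` for EVERY structure function** (real zeros allowed):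
for `E` Hermite–Biehler, `F` entire with `F/E ∈ L²(ℝ)` and `F/E`, `F♯/E = O(1/√(Im z))` far out
in the upper half-plane, `(F, K(w, ·))_{𝓗(E)} = F(w)` at every non-real `w`. Proof: as in the
tree's `deBrangesInner_deBrangesKernel` (Cauchy's theorem and formula along `ℝ`), applied to
the continuations of `F/E` and `F♯/E` across the real zeros of `E`
(`exists_continuation_div`), which agree with the quotients almost everywhere on `ℝ`.
[cite: deBranges1986, p. 3] -/
theorem deBrangesInner_deBrangesKernel_of_isHermiteBiehler (hE : IsHermiteBiehler E)
    {F : ℂ → ℂ} (hF : Differentiable ℂ F) (hF2 : Integrable fun x : ℝ => ‖F x / E x‖ ^ 2)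
    (hFb : ∃ C R₀ : ℝ, ∀ z : ℂ, 0 < z.im → R₀ ≤ ‖z‖ →
      ‖F z / E z‖ ≤ C / √z.im ∧ ‖sharp F z / E z‖ ≤ C / √z.im)
    {w : ℂ} (hw : w.im ≠ 0) :
    deBrangesInner E F (deBrangesKernel E w) = F w := by
  have hd := hE.differentiable
  obtain ⟨C, R₀, hb⟩ := hFb
  have hC' : 0 ≤ max C 0 := le_max_right _ _
  have hb1 : ∀ z : ℂ, 0 < z.im → R₀ ≤ ‖z‖ → ‖F z / E z‖ ≤ max C 0 / √z.im :=
    fun z hz hR => (hb z hz hR).1.trans (by gcongr; exact le_max_left _ _)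
  have hb2 : ∀ z : ℂ, 0 < z.im → R₀ ≤ ‖z‖ → ‖sharp F z / E z‖ ≤ max C 0 / √z.im :=
    fun z hz hR => (hb z hz hR).2.trans (by gcongr; exact le_max_left _ _)
  have hi2 : Integrable fun x : ℝ => ‖sharp F x / E x‖ ^ 2 := by
    refine hF2.congr (ae_of_all _ fun x => ?_)
    simp only [norm_div, sharp_ofReal, Complex.norm_conj]
  -- the continuations of `F/E` and `F♯/E`
  obtain ⟨Q, hQd, hQeq⟩ := exists_continuation_div hE hF hF2
  obtain ⟨Q', hQ'd, hQ'eq⟩ := exists_continuation_div hE (differentiable_sharp hF) hi2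
  have hae : ∀ᵐ x : ℝ, E x ≠ 0 :=
    ae_ne_zero_of_differentiable hd (hE.ne_zero_of_im_pos (z := I) (by simp))
  have hQx : (fun x : ℝ => F x / E x) =ᵐ[volume] fun x : ℝ => Q x :=
    hae.mono fun x hx => (hQeq x hx).symm
  have hQ'x : (fun x : ℝ => sharp F x / E x) =ᵐ[volume] fun x : ℝ => Q' x :=
    hae.mono fun x hx => (hQ'eq x hx).symm
  have hQ2 : Integrable fun x : ℝ => ‖Q x‖ ^ 2 :=
    hF2.congr (hQx.mono fun x hx => by simp only [hx])
  have hQ'2 : Integrable fun x : ℝ => ‖Q' x‖ ^ 2 :=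
    hi2.congr (hQ'x.mono fun x hx => by simp only [hx])
  have hQb : ∀ z : ℂ, 0 < z.im → R₀ ≤ ‖z‖ → ‖Q z‖ ≤ max C 0 / √z.im := fun z hz hR => by
    rw [hQeq z (hE.ne_zero_of_im_pos hz)]
    exact hb1 z hz hR
  have hQ'b : ∀ z : ℂ, 0 < z.im → R₀ ≤ ‖z‖ → ‖Q' z‖ ≤ max C 0 / √z.im := fun z hz hR => by
    rw [hQ'eq z (hE.ne_zero_of_im_pos hz)]
    exact hb2 z hz hR
  -- integrability of the two pieces of the integrand
  have hFm := aestronglyMeasurable_div_of_differentiable' hd hF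
  have hsFm := aestronglyMeasurable_div_of_differentiable' hd (differentiable_sharp hF)
  have hA : Integrable fun x : ℝ => E w * (F x / E x / (x - w)) :=
    (integrable_div_ofReal_sub hFm hF2 hw).const_mul _
  have hcw : (conj w).im ≠ 0 := by simpa using hw
  have hB0 : Integrable fun x : ℝ => sharp F x / E x / (x - conj w) :=
    integrable_div_ofReal_sub hsFm hi2 hcw
  have hB : Integrable fun x : ℝ => sharp E w * conj (sharp F x / E x / (x - conj w)) :=
    (integrable_conj hB0).const_mul _
  unfold deBrangesInner
  simp_rw [inner_kernel_integrand' (E := E) F hw]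
  rw [MeasureTheory.integral_const_mul, integral_sub hA hB, MeasureTheory.integral_const_mul,
    MeasureTheory.integral_const_mul, integral_conj]
  -- pass to the continuations (equal almost everywhere on `ℝ`)
  have e1 : ∫ x : ℝ, F x / E x / (x - w) = ∫ x : ℝ, Q x / (x - w) :=
    integral_congr_ae (hQx.mono fun x hx => by simp only [hx])
  have e2 : ∫ x : ℝ, sharp F x / E x / (x - conj w) = ∫ x : ℝ, Q' x / (x - conj w) :=
    integral_congr_ae (hQ'x.mono fun x hx => by simp only [hx])
  rw [e1, e2]
  have hπ : (2 * π * I : ℂ) ≠ 0 := by simp [Real.pi_ne_zero]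
  rcases lt_or_gt_of_ne hw with hneg | hpos
  · -- `Im w < 0`: Cauchy's theorem for `Q`, Cauchy's formula for `Q'` at `w̄`
    have hcwpos : 0 < (conj w).im := by simpa using hneg
    rw [integral_div_sub_eq_zero_of_im_neg hC' hQd hQ2 hQb hneg,
      integral_div_sub_eq_of_im_pos hC' hQ'd hQ'2 hQ'b hcwpos,
      hQ'eq (conj w) (hE.ne_zero_of_im_pos hcwpos)]
    have hEw : sharp E w ≠ 0 := by
      rw [sharp_apply, map_ne_zero]
      exact hE.ne_zero_of_im_pos hcwpos
    simp only [sharp_apply, Complex.conj_conj, map_mul, map_div₀, Complex.conj_I, map_ofNat,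
      Complex.conj_ofReal] at hEw ⊢
    field_simp
    ring
  · -- `Im w > 0`: Cauchy's formula for `Q` at `w`, Cauchy's theorem for `Q'`
    have hcwneg : (conj w).im < 0 := by simpa using hpos
    rw [integral_div_sub_eq_of_im_pos hC' hQd hQ2 hQb hpos,
      integral_div_sub_eq_zero_of_im_neg hC' hQ'd hQ'2 hQ'b hcwneg,
      hQeq w (hE.ne_zero_of_im_pos hpos)]
    have hEw : E w ≠ 0 := hE.ne_zero_of_im_pos hpos
    simp only [map_zero, mul_zero, sub_zero]
    field_simp


end Literature.Analysis.DeBrangesSpaces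

end
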